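import Literature.IUT.HodgeArakelov.AbsTopMonoidsGenuineGhatLevels
import Literature.NumberTheory.GaloisRepresentations.LocalGlobalCohomologyFiniteProofs
import Literature.NumberTheory.GaloisRepresentations.LocalFieldFiniteExtension
import Mathlib.CategoryTheory.CofilteredSystem
import HarnessLib

/-!
# [IUTchII] Example 1.8 (vii) `(∗ĝp)` GENUINE, part 6: DENSITY of `η((k̄^J)^×)` in the levels `((k̄^×)^J)^∧` of `O^ĝp(G)`
# — `((k̄^×)^J)^∧ = η((k̄^×)^J) · (((k̄^×)^J)^∧)ⁿ` for every `n`

S. Mochizuki, *Inter-universal Teichmüller theory II*, §1, Example 1.8 (vii) p. 40 / Remark 1.11.1 (i) (c) p. 50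
[claim: Mochizuki2012, status: disputed] (IUTchII §1 Ex 1.8 (vii), kurims p.40); [cite: NeukirchANT1999, Ch. IV §2 p.274];
[cite: SerreGaloisCohomology1997, II §5.1 (a)] (`k^×/(k^×)ⁿ` finite for a local field).  abc-iut cell, layer L6, row
«GHATGP-GENUINE» STAGE 3c (seat abc-iut-L6-d2 gen 6; post-freeze def, reading (ii): the defs are the index type `DivIdx`,
the inverse system `rootSystem`, `levelField`, `fixedUnitsEquiv`).  Input of the kernel clause of Rmk. 1.11.1 (i) (c)
(extension of "`ψ = id` on `η(k̄^×)`" to all of `O^ĝp`).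

* `PowCompletion.exists_pow_eq_of_component_eq_one` — for a commutative group `A` with FINITE quotients `A/Aⁿ`, an
  element of `Â` with trivial `k`-th component is a `k`-th power (KÖNIG's lemma, Mathlib
  `nonempty_sections_of_finite_inverse_system`, on the finite nonempty solution sets `{t ∈ A/Aⁿ | tᵏ = v_n}` indexed
  by divisibility); hence **`PowCompletion.exists_eq_of_mul_pow`**: `Â = η(A) · Âᵏ`.
* `Genuine.finite_level_quot` — `(k̄^×)^J / ((k̄^×)^J)ⁿ` is FINITE for `J` open: `(k̄^×)^J ≅ (k̄^J)^×`
  (`fixedUnitsEquiv`), `k̄^J` is a finite extension of the MLF `k` hence a nonarchimedean local field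
  (abc-iut `FiniteExtension.isNonarchimedeanLocalField`) with finite `L^×/(L^×)ⁿ`
  (`finite_quotient_range_powMonoidHom_units`, Literature.NumberTheory.GaloisRepresentations).
* **`Genuine.level_density`** — every `x ∈ ((k̄^×)^J)^∧` is `η(a) · yⁿ` with `a ∈ (k̄^×)^J`.

HONEST FRAMING: classical algebra / local fields over OUR typed objects; nothing here bears on [IUTchIII] Cor. 3.12;
typed ≠ proved elsewhere.
-/

set_option autoImplicit false

noncomputable section

namespace Literature.IUT.HodgeArakelov

open CategoryTheory
open Literature.AnabelianGeometry.AbsoluteAnabelian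

/-! ## Density `Â = η(A)·Âᵏ` when the quotients `A/Aⁿ` are finite (König's lemma along divisibility) -/

namespace PowCompletion

variable {A : Type} [CommGroup A]

/-- The positive naturals ordered by DIVISIBILITY (index category for König's lemma). [cite: NeukirchANT1999, Ch. IV §2 p.274] -/
structure DivIdx : Type where
  /-- the level -/
  n : ℕ+

/-- `DivIdx` preorder. [cite: NeukirchANT1999, Ch. IV §2 p.274] -/
instance : Preorder DivIdx where
  le a b := (a.n : ℕ) ∣ b.n
  le_refl _ := dvd_rfl
  le_trans _ _ _ h₁ h₂ := dvd_trans h₁ h₂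

/-- `DivIdx` is directed. [cite: NeukirchANT1999, Ch. IV §2 p.274] -/
instance : IsDirectedOrder DivIdx :=
  ⟨fun a b => ⟨⟨a.n * b.n⟩, Dvd.intro _ rfl, Dvd.intro_left _ rfl⟩⟩

/-- `DivIdx` is nonempty. [cite: NeukirchANT1999, Ch. IV §2 p.274] -/
instance : Nonempty DivIdx := ⟨⟨1⟩⟩

/-- The inverse system of the SOLUTION SETS `{t ∈ A/Aⁿ | tᵏ = v_n}`. [cite: NeukirchANT1999, Ch. IV §2 p.274] -/
def rootSystem (k : ℕ+) (v : PowCompletion A) : DivIdxᵒᵖ ⥤ Type where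
  obj j := {t : A ⧸ powSubgroup A j.unop.n // t ^ (k : ℕ) = component j.unop.n v}
  map {j j'} f := TypeCat.ofHom fun t => ⟨proj A j'.unop.n j.unop.n f.unop.le t.1, by
    rw [← map_pow, t.2, component_compat]⟩
  map_id j := by
    ext t
    obtain ⟨a, ha⟩ := QuotientGroup.mk_surjective t.1
    change proj A _ _ _ t.1 = t.1
    rw [← ha, proj_mk]
  map_comp {j₁ j₂ j₃} f g := by
    ext t
    obtain ⟨a, ha⟩ := QuotientGroup.mk_surjective t.1
    change proj A _ _ _ t.1 = proj A _ _ _ (proj A _ _ _ t.1)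
    rw [← ha, proj_mk, proj_mk, proj_mk]

/-- The solution sets are nonempty when `v_k = 1`. [cite: NeukirchANT1999, Ch. IV §2 p.274] -/
theorem rootSystem_nonempty (k : ℕ+) (v : PowCompletion A) (hv : component k v = 1) (j : DivIdxᵒᵖ) :
    Nonempty ((rootSystem k v).obj j) := by
  obtain ⟨c, hc⟩ := QuotientGroup.mk_surjective (component (k * j.unop.n) v)
  have h1 : component k v = QuotientGroup.mk c := by
    rw [← component_compat v k (k * j.unop.n) (dvd_mul_right _ _), ← hc, proj_mk]
  rw [hv, eq_comm, QuotientGroup.eq_one_iff, mem_powSubgroup_iff] at h1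
  obtain ⟨e, he⟩ := h1
  refine ⟨⟨QuotientGroup.mk e, ?_⟩⟩
  change (QuotientGroup.mk e : A ⧸ powSubgroup A j.unop.n) ^ (k : ℕ) = component j.unop.n v
  rw [← QuotientGroup.mk_pow, he, ← component_compat v j.unop.n (k * j.unop.n) (dvd_mul_left _ _), ← hc, proj_mk]

/-- **`v_k = 1 ⇒ v ∈ Âᵏ`** when every `A/Aⁿ` is finite (König's lemma on the finite nonempty solution sets).
[cite: NeukirchANT1999, Ch. IV §2 p.274] -/
theorem exists_pow_eq_of_component_eq_one (hfin : ∀ n : ℕ+, Finite (A ⧸ powSubgroup A n)) (k : ℕ+)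
    (v : PowCompletion A) (hv : component k v = 1) : ∃ y : PowCompletion A, y ^ (k : ℕ) = v := by
  haveI : ∀ j : DivIdxᵒᵖ, Finite ((rootSystem k v).obj j) := fun j => Subtype.finite
  haveI : ∀ j : DivIdxᵒᵖ, Nonempty ((rootSystem k v).obj j) := rootSystem_nonempty k v hv
  obtain ⟨s, hs⟩ := nonempty_sections_of_finite_inverse_system (rootSystem k v)
  refine ⟨mk (fun n => (s (Opposite.op ⟨n⟩)).1) fun m n h => ?_, ?_⟩
  · have := hs (j := Opposite.op ⟨n⟩) (j' := Opposite.op ⟨m⟩) (Quiver.Hom.op (homOfLE h))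
    rw [← this]
    rfl
  · ext n
    rw [map_pow, component_mk]
    exact (s (Opposite.op ⟨n⟩)).2

/-- **DENSITY `Â = η(A) · Âᵏ`**: when every `A/Aⁿ` is finite, each `x ∈ Â` is `η(a) · yᵏ`.
[cite: NeukirchANT1999, Ch. IV §2 p.274] -/
theorem exists_eq_of_mul_pow (hfin : ∀ n : ℕ+, Finite (A ⧸ powSubgroup A n)) (k : ℕ+) (x : PowCompletion A) :
    ∃ (a : A) (y : PowCompletion A), x = of A a * y ^ (k : ℕ) := by
  obtain ⟨a, ha⟩ := QuotientGroup.mk_surjective (component k x)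
  obtain ⟨y, hy⟩ := exists_pow_eq_of_component_eq_one hfin k (x * (of A a)⁻¹)
    (by rw [map_mul, map_inv, component_of, ha, mul_inv_cancel])
  exact ⟨a, y, by rw [hy, mul_comm x, ← mul_assoc, mul_inv_cancel, one_mul]⟩

end PowCompletion

/-! ## The levels `(k̄^×)^J` have finite power-quotients (`(k̄^J)^×/((k̄^J)^×)ⁿ` finite: local field) -/

namespace AbsTopMonoids.Genuine

variable (C : MLFClosure.{0})

/-- The fixed field `k̄^J` as a type. [claim: Mochizuki2012, status: disputed] (IUTchII §1 Ex 1.8 (vii), kurims p.40) -/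
abbrev levelField (J : OpenSubgroup (C.K ≃ₐ[C.k] C.K)) : Type :=
  ↥(IntermediateField.fixedField (J : Subgroup (C.K ≃ₐ[C.k] C.K)))

/-- `(k̄^×)^J ≅ (k̄^J)^×` (the invariant units are the units of the fixed field).
[claim: Mochizuki2012, status: disputed] (IUTchII §1 Ex 1.8 (vii), kurims p.40) -/
def fixedUnitsEquiv (J : OpenSubgroup (C.K ≃ₐ[C.k] C.K)) :
    fixedUnits C (J : Subgroup (C.K ≃ₐ[C.k] C.K)) ≃* (levelField C J)ˣ :=
  { toFun := fun x => Units.mk0 (⟨((x : (C.K)ˣ) : C.K), (IntermediateField.mem_fixedField_iff _ _).mpr x.2⟩ : levelField C J)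
      (fun h => (x : (C.K)ˣ).ne_zero (congrArg Subtype.val h))
    invFun := fun u => ⟨Units.mk0 ((u : levelField C J) : C.K) (fun h => u.ne_zero (Subtype.ext h)),
      fun σ hσ => (IntermediateField.mem_fixedField_iff _ _).mp (u : levelField C J).2 σ hσ⟩
    left_inv := fun _ => Subtype.ext (Units.ext rfl)
    right_inv := fun _ => Units.ext (Subtype.ext rfl)
    map_mul' := fun _ _ => Units.ext (Subtype.ext rfl) }

/-- **`(k̄^×)^J / ((k̄^×)^J)ⁿ` is finite** for `J` open: `k̄^J` is a finite extension of the MLF `k`, hence a nonarchimedean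
local field (abc-iut `FiniteExtension.isNonarchimedeanLocalField`), whose `L^×/(L^×)ⁿ` is finite
(`finite_quotient_range_powMonoidHom_units`, Serre *Cohomologie galoisienne* II §5.1).
[cite: SerreGaloisCohomology1997, II §5.1 (a)] -/
theorem finite_level_quot (J : OpenSubgroup (C.K ≃ₐ[C.k] C.K)) (n : ℕ+) :
    Finite (fixedUnits C (J : Subgroup (C.K ≃ₐ[C.k] C.K)) ⧸
      PowCompletion.powSubgroup (fixedUnits C (J : Subgroup (C.K ≃ₐ[C.k] C.K))) n) := by
  let L : Type := levelField C J
  haveI : FiniteDimensional C.k L := finiteDimensional_fixedField C J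
  letI := Literature.NumberTheory.GaloisRepresentations.FiniteExtension.normedField C.k L
  letI := Literature.NumberTheory.GaloisRepresentations.FiniteExtension.valuativeRel C.k L
  haveI := Literature.NumberTheory.GaloisRepresentations.FiniteExtension.isNonarchimedeanLocalField C.k L
  have hn : ((n : ℕ) : L) ≠ 0 := Nat.cast_ne_zero.mpr n.ne_zero
  haveI hfin := Literature.NumberTheory.GaloisRepresentations.finite_quotient_range_powMonoidHom_units L n hn
  -- transport along `(k̄^×)^J ≅ L^×`
  let e := fixedUnitsEquiv C J
  have he : (PowCompletion.powSubgroup (fixedUnits C (J : Subgroup (C.K ≃ₐ[C.k] C.K))) n).map e.toMonoidHom =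
      (powMonoidHom (n : ℕ) : Lˣ →* Lˣ).range := by
    ext u
    simp only [Subgroup.mem_map, PowCompletion.mem_powSubgroup_iff, MonoidHom.mem_range, powMonoidHom_apply]
    constructor
    · rintro ⟨x, ⟨b, rfl⟩, rfl⟩
      exact ⟨e b, (map_pow e b _).symm⟩
    · rintro ⟨w, rfl⟩
      exact ⟨e.symm w ^ (n : ℕ), ⟨e.symm w, rfl⟩, by
        change e (e.symm w ^ (n : ℕ)) = w ^ (n : ℕ)
        rw [map_pow, MulEquiv.apply_symm_apply]⟩
  exact Finite.of_equiv _ (QuotientGroup.congr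
    (PowCompletion.powSubgroup (fixedUnits C (J : Subgroup (C.K ≃ₐ[C.k] C.K))) n)
    ((powMonoidHom (n : ℕ) : Lˣ →* Lˣ).range) e he).toEquiv.symm

/-- **DENSITY at the levels**: every `x ∈ ((k̄^×)^J)^∧` is `η(a) · yⁿ` with `a ∈ (k̄^×)^J` (`J` open).
[claim: Mochizuki2012, status: disputed] (IUTchII §1 Ex 1.8 (vii), kurims p.40) -/
theorem level_density (J : OpenSubgroup (C.K ≃ₐ[C.k] C.K)) (n : ℕ+) (x : levelGroup C ⟨J⟩) :
    ∃ (a : fixedUnits C (J : Subgroup (C.K ≃ₐ[C.k] C.K))) (y : levelGroup C ⟨J⟩),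
      x = PowCompletion.of _ a * y ^ (n : ℕ) :=
  PowCompletion.exists_eq_of_mul_pow (finite_level_quot C J) n x

end AbsTopMonoids.Genuine

end Literature.IUT.HodgeArakelov

end
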